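import Summits.NavierStokesRegularity.NavierStokesRegularity.Theorems.QuietScarPocketDoorZoomEnergies
import Literature.Analysis.FluidPDE.PineauVicolOneSliceAssembly
import Literature.Analysis.FluidPDE.ClassicalTopPointRegularity
import Literature.Analysis.FluidPDE.LocalTypeIScaling
import Literature.Analysis.FluidPDE.SuitableWeakInBallTools
import Literature.Analysis.FluidPDE.TypeIAncientMildRescale

/-!
# QuietScarPocketDoorZoomBall — door S31 «QuietScarPocketDoor» (nsreg-p1 g25 ROUND-29 v2.1, texts `r29/Sketch31.lean`
# 363b5766493b6c28; Defs p622283), K-piece PK1 `scarPocketZoom_holds`, file F2′: THE ZOOMED PAIR IN THE ENGINE'S CLASS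

The class-zoom engine `LocalTypeIBlowup.exists_typeIAncientMild_zoomLimit_seq` eats, for every member of the sequence, a pair
suitable in the unit parabolic ball with a weak gradient, a bound on `𝐈(Q(0,1))`, continuity, the Type-I RATE, and a backward
singular vertex.  For the `μ`-zoom `v = nsRescale μ u`, `q = nsRescalePressure μ p` of a Pineau–Vicol pair this file supplies:

* `pv_zoom_ballData` (F2′): suitability in `Q(0,1)` (ns-s29-p2/Pineau–Vicol one-slice tools: `pineauVicol_zoom`,
  `exists_lintegral_ball_enorm_sq_nsRescale_le`, `lintegral_parabolicCylinder_one_fderiv_nsRescale_lt_top`,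
  `memLp_nsRescalePressure_threeHalves`, `isSuitableWeakSolutionInBall_of_classical`), the classical weak gradient, the
  transport of `𝐈(Q(0,μ)) ≤ I` to `𝐈(Q(0,1)) ≤ I` (`typeIBound_nsZoom`), continuity and the rate `‖v‖ ≤ C_u/√(−s)`;
* F2″ (`isBackwardSingularPoint_nsRescale_of_not_bounded`, the backward singular vertex of the zoom) is ns-sz-p1 g4's file
  `Theorems/QuietScarPocketDoorZoomApexSingular.lean` (p624762).

Door S31 is a regularity CRITERION about a HYPOTHETICAL one-point Type-I blow-up; item 0056 `NoTypeII` and NS regularity are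
NOT proved and stay OPEN.
-/

noncomputable section

set_option linter.dupNamespace false

namespace Summit.NavierStokesRegularity.NavierStokesRegularity.Theorems.QuietScarPocketDoor

open MeasureTheory Set Function Filter Topology TopologicalSpace Metric
open scoped NNReal ENNReal Topology
open Literature.Analysis Literature.Analysis.FluidPDE

/-- the zoomed pressure is the `c²`-weighted pull-back. -/
theorem nsRescalePressure_eq_smul_stPull_zero (c : ℝ) (p : ℝ → EuclideanSpace ℝ (Fin 3) → ℝ) :
    nsRescalePressure c p = c ^ 2 • stPull (c ^ 2) c 0 (0 : EuclideanSpace ℝ (Fin 3)) p := by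
  funext s y
  simp only [nsRescalePressure_apply, Pi.smul_apply, stPull_apply, zero_add, smul_eq_mul]

/-- **F2′ — the `μ`-zoom of a Pineau–Vicol pair is in the class of the zoom engine on the unit parabolic ball.** -/
theorem pv_zoom_ballData {Cu Cp μ : ℝ} {I : ℝ≥0∞} {u : ℝ → EuclideanSpace ℝ (Fin 3) → EuclideanSpace ℝ (Fin 3)}
    {p : ℝ → EuclideanSpace ℝ (Fin 3) → ℝ}
    (hreg : IsClassicalNSSolutionOnRegion (Ico (-1 : ℝ) 0 ×ˢ ball (0 : EuclideanSpace ℝ (Fin 3)) 1) 1 0 u p)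
    (hI : ∀ t ∈ Ico (-1 : ℝ) 0, ∀ x ∈ ball (0 : EuclideanSpace ℝ (Fin 3)) 1, ‖u t x‖ ≤ Cu / (Real.sqrt (-t) + ‖x‖))
    (hP : ∀ t ∈ Ico (-1 : ℝ) 0, ∀ x : EuclideanSpace ℝ (Fin 3), 1 / 2 < ‖x‖ → ‖x‖ < 3 / 4 → |p t x| ≤ Cp)
    (hμ : 0 < μ) (hμ1 : μ ≤ 1 / 64)
    (hIμ : typeIBound (parabolicCylinder μ (0 : ℝ × EuclideanSpace ℝ (Fin 3))) u p (fun t x => fderiv ℝ (u t) x) ≤ I) :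
    IsSuitableWeakSolutionInBall 1 0 (nsRescale μ u) (nsRescalePressure μ p) ∧
    HasWeakSpatialGradientOn (parabolicCylinderOpens 1 (0 : ℝ × EuclideanSpace ℝ (Fin 3))) (nsRescale μ u)
      (fun t x => fderiv ℝ (nsRescale μ u t) x) ∧
    typeIBound (parabolicCylinder 1 (0 : ℝ × EuclideanSpace ℝ (Fin 3))) (nsRescale μ u) (nsRescalePressure μ p)
      (fun t x => fderiv ℝ (nsRescale μ u t) x) ≤ I ∧
    ContinuousOn (uncurry (nsRescale μ u)) (parabolicCylinder 1 (0 : ℝ × EuclideanSpace ℝ (Fin 3))) ∧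
    (∀ (t : ℝ) (x : EuclideanSpace ℝ (Fin 3)), (t, x) ∈ parabolicCylinder 1 (0 : ℝ × EuclideanSpace ℝ (Fin 3)) →
      ‖nsRescale μ u t x‖ ≤ Cu / Real.sqrt ((0 : ℝ × EuclideanSpace ℝ (Fin 3)).1 - t)) := by
  have hμ' : μ ≤ 1 := hμ1.trans (by norm_num)
  have hCu : 0 ≤ Cu := pv_typeI_const_nonneg hI
  have hv : IsClassicalNSSolutionOnRegion (parabolicCylinder 1 (0 : ℝ × EuclideanSpace ℝ (Fin 3))) 1 0
      (nsRescale μ u) (nsRescalePressure μ p) := hreg.pineauVicol_zoom hμ hμ'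
  obtain ⟨C, hC⟩ := exists_lintegral_ball_enorm_sq_nsRescale_le hμ hμ' hI
  have hG := lintegral_parabolicCylinder_one_fderiv_nsRescale_lt_top hreg hI hP hμ (hμ1.trans (by norm_num))
  have hq := memLp_nsRescalePressure_threeHalves hreg hI hP hμ (hμ1.trans (by norm_num))
  have hball : IsSuitableWeakSolutionInBall 1 0 (nsRescale μ u) (nsRescalePressure μ p) :=
    isSuitableWeakSolutionInBall_of_classical hv hC hG hq
  have hwg : HasWeakSpatialGradientOn (parabolicCylinderOpens 1 (0 : ℝ × EuclideanSpace ℝ (Fin 3))) (nsRescale μ u)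
      (fun t x => fderiv ℝ (nsRescale μ u t) x) :=
    hv.hasWeakSpatialGradientOn (isOpen_parabolicCylinder 1 0) (by rw [coe_parabolicCylinderOpens])
  have hcont : ContinuousOn (uncurry (nsRescale μ u)) (parabolicCylinder 1 (0 : ℝ × EuclideanSpace ℝ (Fin 3))) :=
    hv.smooth_velocity.continuousOn
  -- transport of `𝐈`
  have hIt : typeIBound (parabolicCylinder 1 (0 : ℝ × EuclideanSpace ℝ (Fin 3))) (nsRescale μ u) (nsRescalePressure μ p)
      (fun t x => fderiv ℝ (nsRescale μ u t) x) ≤ I := by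
    have h := typeIBound_nsZoom hμ (0 : ℝ × EuclideanSpace ℝ (Fin 3)).1 (0 : ℝ × EuclideanSpace ℝ (Fin 3)).2
      (parabolicCylinder μ (0 : ℝ × EuclideanSpace ℝ (Fin 3))) u p (fun t x => fderiv ℝ (u t) x)
    rw [zoom_preimage_parabolicCylinder_self hμ] at h
    simp only [Prod.fst_zero, Prod.snd_zero] at h
    rw [fderiv_nsRescale_eq_smul_stPull, nsRescale_eq_smul_stPull_zero, nsRescalePressure_eq_smul_stPull_zero, h]
    exact hIμ
  refine ⟨hball, hwg, hIt, hcont, fun t x htx => ?_⟩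
  have h := norm_nsRescale_le_of_typeI hμ hμ' hI htx
  obtain ⟨ht, -⟩ := mem_prod.1 htx
  simp only [Prod.fst_zero, one_pow, zero_sub] at ht
  have hs : 0 < Real.sqrt (-t) := Real.sqrt_pos.2 (by linarith [ht.2])
  simp only [Prod.fst_zero, zero_sub]
  exact h.trans (div_le_div_of_nonneg_left hCu hs (le_add_of_nonneg_right (norm_nonneg _)))

end Summit.NavierStokesRegularity.NavierStokesRegularity.Theorems.QuietScarPocketDoor

end
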